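import Literature.NumberTheory.LFunctions.ZetaArgRHExtremalBounds
import Literature.NumberTheory.LFunctions.ZetaZeroWindowsExplicit
import Mathlib.Analysis.Real.Pi.Bounds
import Mathlib.Analysis.Complex.ExponentialBounds
import HarnessLib

/-!
# RH-CONDITIONAL — Goldston–Gonek, Corollary 1 (1.9): on RH every zero of `ζ` has multiplicity `m(γ) ≤ (½ + o(1)) log γ/log log γ`, PROVED from the Carneiro–Chandee–Milinovich bound («nothing here bears on the truth of RH»)

Topic `Literature/NumberTheory/LFunctions` (RH literature-typing tranche 1, L4 "explicit zero
statistics"; companion of `ZetaZeroGapsRHGoldstonGonek.lean` (Theorem 1 as a named fact and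
Corollary 1 (1.10), the maximal gap `(π + o(1))/log log γ`, proved), of `ZetaArgRHExtremalBounds.lean`
(CCM 2013: `|S(t)| ≤ (¼ + o(1)) log t/log log t` on RH, named fact) and of the RH-free
`ZetaZeroWindowsExplicit.lean` (`m(ρ) ≤ N(γ) − N(γ−h)` and the window inequality)).
Label: **RH-CONDITIONAL** — everything in this file is a THEOREM; the Riemann hypothesis and the
published bound of Carneiro–Chandee–Milinovich enter as explicit hypotheses `(hRH : RiemannHypothesis)`,
`(h : CarneiroChandeeMilinovich2013_thm1)`.  No named fact and no definition is introduced.  Nothing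
is asserted about RH; nothing here bears on the truth of RH.

Source: D. A. Goldston, S. M. Gonek, *A note on `S(t)` and the zeros of the Riemann
zeta-function*, Bull. Lond. Math. Soc. **39** (2007) 482–486 (arXiv:math/0511092), Corollary 1,
first part, (1.9): "Assume the Riemann Hypothesis. Let `m(γ)` denote the multiplicity of the zero
`½ + iγ`. Then if `γ` is sufficiently large we have `m(γ) ≤ (½ + o(1)) log γ/log log γ`."

* `Literature.NumberTheory.LFunctions.multiplicity_of_S_bound` — RH-free implication with explicit
  thresholds: `|S(t)| ≤ c log t/log log t` on `t ≥ t₁` gives `m(ρ) ≤ (2c + δ) log γ/log log γ` for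
  `γ = Im ρ ≥ max(t₁ + 1, 31, 1 + 2/δ)`, from
  `m(ρ) ≤ N(γ) − N(γ−h) ≤ (h/2π) log(γ/2π) + |S(γ)| + |S(γ−h)| + 2.4/(π(γ−h))`
  (`Literature.NumberTheory.LFunctions.riemannZetaZeroOrder_le_window`,
  `Literature.NumberTheory.LFunctions.ZetaZeroWindows.count_diff_le`), the monotonicity of
  `log t/log log t` on `[e^e, ∞)`, and `h → 0`.
* `Literature.NumberTheory.LFunctions.multiplicity_of_eventual_S_bound` — the `o(1)` form:
  `(c₀ + o(1))`-bounds for `S` give `(2c₀ + o(1))`-bounds for `m`.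
* `Literature.NumberTheory.LFunctions.GoldstonGonek2007_cor1_multiplicity` — **(1.9)**:
  `CarneiroChandeeMilinovich2013_thm1 → (RH → ∀ ε > 0, ∃ γ₀, ∀ ρ, ζ(ρ) = 0 → Im ρ ≥ γ₀ →
  m(ρ) ≤ (½ + ε) log(Im ρ)/log log(Im ρ))` (`2 · ¼ = ½`; Goldston–Gonek obtain the same `½` from the
  `h`-uniform Theorem 1, their Theorem 2 alone would give `1`).

Conventions: `m = Literature.riemannZetaZeroOrder` (the order of `ζ` at `ρ`), `N = zetaZeroCount`,
`S = zetaArgS`.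

## References

* D. A. Goldston, S. M. Gonek, Bull. Lond. Math. Soc. 39 (2007) 482–486, Cor. 1 (1.9)
  (arXiv:math/0511092). [GoldstonGonek2007]
* E. Carneiro, V. Chandee, M. B. Milinovich, Math. Ann. 356 (2013) 939–968, Thm. 1.
  [CarneiroChandeeMilinovich2013]
* E. C. Titchmarsh, *The Theory of the Riemann Zeta-Function*, 2nd ed., §9.2. [Titchmarsh1986]
-/

noncomputable section

open Real

namespace Literature.NumberTheory.LFunctions

/-! ## Corollary 1, (1.9): the maximal multiplicity -/

/-- `t ↦ log t/log log t` is non-decreasing on `[e^e, ∞)` (`x ↦ log x/x` is non-increasing on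
`[e, ∞)`, `Real.log_div_self_antitoneOn`, applied to `x = log t`). [cite: GoldstonGonek2007, §1 (1.9)] -/
private theorem log_div_loglog_mono {t t' : ℝ} (ht : Real.exp (Real.exp 1) ≤ t) (htt' : t ≤ t') :
    Real.log t / Real.log (Real.log t) ≤ Real.log t' / Real.log (Real.log t') := by
  have ht0 : 0 < t := lt_of_lt_of_le (Real.exp_pos _) ht
  have hx : Real.exp 1 ≤ Real.log t := by rw [Real.le_log_iff_exp_le ht0]; exact ht
  have hxx' : Real.log t ≤ Real.log t' := Real.log_le_log ht0 htt'
  have hx' : Real.exp 1 ≤ Real.log t' := hx.trans hxx'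
  have he := Real.exp_one_gt_d9
  have hl0 : 0 < Real.log t := by linarith
  have hl0' : 0 < Real.log t' := by linarith
  have hll : 0 < Real.log (Real.log t) := Real.log_pos (by linarith)
  have hll' : 0 < Real.log (Real.log t') := Real.log_pos (by linarith)
  have h := Real.log_div_self_antitoneOn hx hx' hxx'
  rw [← inv_div (Real.log (Real.log t)), ← inv_div (Real.log (Real.log t'))]
  exact inv_anti₀ (div_pos hll' hl0') h

/-- `e ≤ log t/log log t` for `t > e` (`x/log x ≥ e` for `x > 1`, from `log(x/e) ≤ x/e − 1`).
[cite: GoldstonGonek2007, §1 (1.9)] -/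
private theorem exp_one_le_log_div_loglog {t : ℝ} (ht : Real.exp 1 < t) :
    Real.exp 1 ≤ Real.log t / Real.log (Real.log t) := by
  have ht0 : 0 < t := lt_trans (Real.exp_pos _) ht
  have hx : 1 < Real.log t := by rw [Real.lt_log_iff_exp_lt ht0]; exact ht
  have hll : 0 < Real.log (Real.log t) := Real.log_pos hx
  have he := Real.exp_pos 1
  rw [le_div_iff₀ hll]
  have h1 : Real.log (Real.log t) = Real.log (Real.log t / Real.exp 1) + 1 := by
    rw [Real.log_div (by linarith) he.ne', Real.log_exp]; ring
  have h2 : Real.log (Real.log t / Real.exp 1) ≤ Real.log t / Real.exp 1 - 1 :=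
    Real.log_le_sub_one_of_pos (by positivity)
  rw [h1]
  calc Real.exp 1 * (Real.log (Real.log t / Real.exp 1) + 1)
      ≤ Real.exp 1 * (Real.log t / Real.exp 1) := mul_le_mul_of_nonneg_left (by linarith) he.le
    _ = Real.log t := by field_simp

/-- `e^e ≤ 21`. [cite: GoldstonGonek2007, §1 (1.9)] -/
private theorem exp_exp_one_le : Real.exp (Real.exp 1) ≤ 21 := by
  have he := Real.exp_one_lt_d9
  have he0 := Real.exp_pos 1
  calc Real.exp (Real.exp 1) ≤ Real.exp 3 := Real.exp_le_exp.2 (by linarith)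
    _ = Real.exp 1 ^ 3 := by rw [Real.exp_one_pow]; norm_num
    _ ≤ 2.7182818286 ^ 3 := by gcongr
    _ ≤ 21 := by norm_num

/-- **Maximal multiplicity from an eventual bound for `S(t)`** (RH-free implication): if
`|S(t)| ≤ c log t/log log t` for all `t ≥ t₁`, then every zero `ρ` of `ζ` with
`Im ρ ≥ max(t₁ + 1, 31, 1 + 2/δ)` has multiplicity
`m(ρ) ≤ (2c + δ) log(Im ρ)/log log(Im ρ)` (`δ > 0`):
`m(ρ) ≤ N(γ) − N(γ−h) ≤ (h/2π) log(γ/2π) + |S(γ)| + |S(γ−h)| + 2.4/(π(γ−h))`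
(`Literature.NumberTheory.LFunctions.riemannZetaZeroOrder_le_window`,
`Literature.NumberTheory.LFunctions.ZetaZeroWindows.count_diff_le`), `log t/log log t` is
non-decreasing, and `h → 0`. [cite: GoldstonGonek2007, §1 Cor. 1 (1.9)] -/
theorem multiplicity_of_S_bound {c δ t₁ : ℝ} (hc : 0 ≤ c) (hδ : 0 < δ)
    (hS : ∀ t : ℝ, t₁ ≤ t → |zetaArgS t| ≤ c * Real.log t / Real.log (Real.log t))
    {ρ : ℂ} (hρ : riemannZeta ρ = 0) (h₁ : t₁ + 1 ≤ ρ.im) (h31 : 31 ≤ ρ.im)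
    (hδγ : 1 + 2 / δ ≤ ρ.im) :
    (riemannZetaZeroOrder ρ : ℝ) ≤ (2 * c + δ) * Real.log ρ.im / Real.log (Real.log ρ.im) := by
  set γ := ρ.im with hγdef
  have hπ := Real.pi_pos
  have hπ3 := Real.pi_lt_d2
  have hπ' := Real.pi_gt_three
  have he := Real.exp_one_lt_d9
  have he' := Real.exp_one_gt_d9
  have hee := exp_exp_one_le
  set f : ℝ := Real.log γ / Real.log (Real.log γ) with hf
  have hfe : Real.exp 1 ≤ f := exp_one_le_log_div_loglog (by linarith)
  have hf1 : 1 ≤ f := by linarith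
  have hlog0 : 0 < Real.log (γ / (2 * π)) :=
    Real.log_pos (by rw [lt_div_iff₀ (by positivity)]; linarith)
  have hS0 : |zetaArgS γ| ≤ c * f := by
    have := hS γ (by linarith); rwa [mul_div_assoc] at this
  -- the remainder `2.4/(π(γ−1)) ≤ δ/2`
  have hγ1 : 0 < γ - 1 := by linarith
  have hrem1 : 2.4 / (π * (γ - 1)) ≤ δ / 2 := by
    rw [div_le_iff₀ (by positivity)]
    have h2 : 2 / δ ≤ γ - 1 := by linarith
    rw [div_le_iff₀ hδ] at h2
    nlinarith
  -- for every `0 < h ≤ 1`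
  have key : ∀ h : ℝ, 0 < h → h ≤ 1 →
      (riemannZetaZeroOrder ρ : ℝ) ≤ h / (2 * π) * Real.log (γ / (2 * π)) + (2 * c * f + δ / 2) := by
    intro h hh hh1
    have hw := riemannZetaZeroOrder_le_window (T₁ := γ - h) hρ (by linarith) (by linarith)
    have hcnt := ZetaZeroWindows.count_diff_le (T := γ - h) (H := h) (by linarith) hh.le
    rw [sub_add_cancel] at hcnt
    have hS1 : |zetaArgS (γ - h)| ≤ c * (Real.log (γ - h) / Real.log (Real.log (γ - h))) := by
      have := hS (γ - h) (by linarith); rwa [mul_div_assoc] at this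
    have hmono : Real.log (γ - h) / Real.log (Real.log (γ - h)) ≤ f :=
      log_div_loglog_mono (by linarith) (by linarith)
    have hS1' : |zetaArgS (γ - h)| ≤ c * f := hS1.trans (mul_le_mul_of_nonneg_left hmono hc)
    have hrem : 2.4 / (π * (γ - h)) ≤ 2.4 / (π * (γ - 1)) := by
      apply div_le_div_of_nonneg_left (by norm_num) (by positivity)
      exact mul_le_mul_of_nonneg_left (by linarith) hπ.le
    linarith
  have hmain : (riemannZetaZeroOrder ρ : ℝ) ≤ 2 * c * f + δ / 2 := by
    refine le_of_forall_pos_le_add fun ε hε ↦ ?_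
    set h : ℝ := min 1 (2 * π * ε / Real.log (γ / (2 * π))) with hh
    have hhpos : 0 < h := lt_min zero_lt_one (by positivity)
    have hh1 : h ≤ 1 := min_le_left _ _
    have hh2 : h ≤ 2 * π * ε / Real.log (γ / (2 * π)) := min_le_right _ _
    have hterm : h / (2 * π) * Real.log (γ / (2 * π)) ≤ ε := by
      rw [le_div_iff₀ hlog0] at hh2
      rw [div_mul_eq_mul_div, div_le_iff₀ (by positivity)]
      linarith
    linarith [key h hhpos hh1]
  have hδf : δ / 2 ≤ δ * f := by nlinarith
  calc (riemannZetaZeroOrder ρ : ℝ) ≤ 2 * c * f + δ * f := by linarith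
    _ = (2 * c + δ) * Real.log γ / Real.log (Real.log γ) := by rw [hf]; ring

/-- **Maximal multiplicity from an EVENTUAL `S`-bound**: if for every `ε > 0` eventually
`|S(t)| ≤ (c₀ + ε) log t/log log t`, then for every `ε > 0` every zero with large enough ordinate
has multiplicity `≤ (2c₀ + ε) log γ/log log γ`. [cite: GoldstonGonek2007, §1 Cor. 1 (1.9)] -/
theorem multiplicity_of_eventual_S_bound {c₀ : ℝ} (hc₀ : 0 ≤ c₀)
    (hS : ∀ ε : ℝ, 0 < ε → ∃ t₁ : ℝ, ∀ t : ℝ, t₁ ≤ t →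
      |zetaArgS t| ≤ (c₀ + ε) * Real.log t / Real.log (Real.log t))
    {ε : ℝ} (hε : 0 < ε) :
    ∃ γ₀ : ℝ, ∀ ρ : ℂ, riemannZeta ρ = 0 → γ₀ ≤ ρ.im →
      (riemannZetaZeroOrder ρ : ℝ) ≤ (2 * c₀ + ε) * Real.log ρ.im / Real.log (Real.log ρ.im) := by
  obtain ⟨t₁, ht₁⟩ := hS (ε / 4) (by positivity)
  refine ⟨max (t₁ + 1) (max 31 (1 + 2 / (ε / 2))), fun ρ hρ hγ ↦ ?_⟩
  have h1 : t₁ + 1 ≤ ρ.im := le_trans (le_max_left _ _) hγ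
  have h2 : 31 ≤ ρ.im := le_trans ((le_max_left _ _).trans (le_max_right _ _)) hγ
  have h3 : 1 + 2 / (ε / 2) ≤ ρ.im := le_trans ((le_max_right _ _).trans (le_max_right _ _)) hγ
  have h := multiplicity_of_S_bound (c := c₀ + ε / 4) (δ := ε / 2) (by positivity) (by positivity)
    ht₁ hρ h1 h2 h3
  have e : 2 * (c₀ + ε / 4) + ε / 2 = 2 * c₀ + ε := by ring
  rwa [e] at h

/-- **Goldston–Gonek 2007, Corollary 1, (1.9), PROVED from Carneiro–Chandee–Milinovich's
Theorem 1**: assume RH; then the multiplicity `m(γ)` of the zero `½ + iγ` satisfies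
`m(γ) ≤ (½ + o(1)) log γ/log log γ` — here: for every `ε > 0` there is `γ₀` such that every zero
`ρ` of `ζ` with `Im ρ ≥ γ₀` has `m(ρ) ≤ (½ + ε) log(Im ρ)/log log(Im ρ)`
(`m = Literature.riemannZetaZeroOrder`; `2 · ¼ = ½` from `CarneiroChandeeMilinovich2013_thm1.littlewood`).
[cite: GoldstonGonek2007, §1 Cor. 1 (1.9)] -/
theorem GoldstonGonek2007_cor1_multiplicity (h : CarneiroChandeeMilinovich2013_thm1)
    (hRH : RiemannHypothesis) {ε : ℝ} (hε : 0 < ε) :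
    ∃ γ₀ : ℝ, ∀ ρ : ℂ, riemannZeta ρ = 0 → γ₀ ≤ ρ.im →
      (riemannZetaZeroOrder ρ : ℝ) ≤ (1 / 2 + ε) * Real.log ρ.im / Real.log (Real.log ρ.im) := by
  have hS : ∀ ε : ℝ, 0 < ε → ∃ t₁ : ℝ, ∀ t : ℝ, t₁ ≤ t →
      |zetaArgS t| ≤ (1 / 4 + ε) * Real.log t / Real.log (Real.log t) :=
    fun ε hε ↦ h.littlewood hRH hε
  have hm := multiplicity_of_eventual_S_bound (c₀ := 1 / 4) (by norm_num) hS hε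
  norm_num at hm ⊢
  exact hm

end Literature.NumberTheory.LFunctions


end
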